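import Mathlib.Analysis.SpecialFunctions.Log.Basic
import Mathlib.Algebra.Order.Archimedean.Basic
import Literature.MathematicalPhysics.QuantumLattice.TorusShellCounting
import HarnessLib

/-!
# The torus Cooper logarithm: `Σ_k β/(2 + β|ε_L(k) - μ|) ≲ (1 + log β) L² + β L`

Topic `MathematicalPhysics/QuantumLattice`; continuation of `TorusShellCounting.lean`
(`card_torusShell_le`: `#{k : |ε_L(k) - μ| < η} ≤ 4L(ηL/(2π√(d₀/8)) + 1)` for `0 < η ≤ d₀/2` when
`μ + 4, -μ ≥ d₀`). For the Fermi-surface weights `w_k = β/(2 + β|ε_L(k) - μ|)`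
(`= B/(1 + B|ξ_k|)`, `B = β/2`, so `w_k ≍ min(β/2, 1/|ξ_k|)`) we PROVE

  `Σ_{k ∈ (ℤ/Lℤ)²} β/(2 + β|ε_L(k) - μ|) ≤ C(d₀)(1 + log β) L² + 8βL`   (`β ≥ 1`, all `L ≥ 1`)

(`exists_sum_fermiWeight_le`), by the pointwise dyadic domination
`B/(1+Bt) ≤ 1/η₀ + Σ_{j ≤ J} (2B/2^j)𝟙[t < 2^j/B]` (`fermiWeight_le_dyadic`, `η₀ = d₀/4 ≤ 2^J/B ≤ d₀/2`,
`J ≲ log β`) and the shell count at the `J + 1` dyadic levels. Divided by `L²` and for `L ≥ β`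
this is the finite-volume Cooper logarithm `L⁻² Σ_k min(β, 1/|ξ_k|) ≲ 1 + log β` of the free
`d = 2` band away from its critical energies (Salmhofer, *Renormalization* (1999) §4.5.4,
(4.200)–(4.203): `B⁻(0) = ½N(0) log β + O(1)`; cf. the lower bound `torusCooperSum ≥ c log L` of
`TorusCooperSumLogBound.lean`). Everything is proved; no definition and no named fact.
-/

noncomputable section

namespace Literature.MathematicalPhysics.QuantumLattice

open Real Set Finset Literature.Probability.LatticeModels

variable {L : ℕ} [NeZero L]

/-! ### The Fermi-surface weight sum `Σ_k β/(2 + β|ξ_k|)` -/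

/-- Pointwise dyadic domination of the weight `B/(1 + Bt)` (`B > 0`, `t ≥ 0`): for a cut-off
`η₀ > 0` and `J` with `η₀ ≤ 2^J/B`,
`B/(1 + Bt) ≤ 1/η₀ + Σ_{j ≤ J} (2B/2^j)·𝟙[t < 2^j/B]`. [folklore] -/
theorem fermiWeight_le_dyadic {B t η₀ : ℝ} (hB : 0 < B) (ht : 0 ≤ t) (hη₀ : 0 < η₀) {J : ℕ}
    (hJ : η₀ ≤ 2 ^ J / B) :
    B / (1 + B * t) ≤ 1 / η₀ + ∑ j ∈ Finset.range (J + 1), (if t < 2 ^ j / B then 2 * B / 2 ^ j else 0) := by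
  have hden : 0 < 1 + B * t := by positivity
  have hsum_nonneg : 0 ≤ ∑ j ∈ Finset.range (J + 1), (if t < 2 ^ j / B then 2 * B / 2 ^ j else 0) :=
    Finset.sum_nonneg fun j _ => by split_ifs <;> positivity
  have hwB : B / (1 + B * t) ≤ B := div_le_self hB.le (by nlinarith)
  have hwt : 0 < t → B / (1 + B * t) ≤ 1 / t := fun htp => by
    rw [div_le_div_iff₀ hden htp]; nlinarith
  by_cases hcase : η₀ ≤ t
  · have h1 : B / (1 + B * t) ≤ 1 / η₀ :=
      (hwt (hη₀.trans_le hcase)).trans (one_div_le_one_div_of_le hη₀ hcase)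
    linarith
  · rw [not_le] at hcase
    -- the least dyadic level above `t`
    have hex : ∃ j, t < 2 ^ j / B := ⟨J, hcase.trans_le hJ⟩
    classical
    set i := Nat.find hex with hi
    have hi_spec : t < 2 ^ i / B := Nat.find_spec hex
    have hi_le : i ≤ J := Nat.find_min' hex (hcase.trans_le hJ)
    have hterm : B / (1 + B * t) ≤ 2 * B / 2 ^ i := by
      rcases Nat.eq_zero_or_pos i with h0 | hpos
      · rw [h0, pow_zero, div_one]; linarith
      · obtain ⟨i', hi'⟩ := Nat.exists_eq_add_one_of_ne_zero hpos.ne'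
        have hlt : i' < Nat.find hex := by rw [← hi, hi']; exact Nat.lt_succ_self i'
        have hnot : ¬ t < 2 ^ i' / B := Nat.find_min hex hlt
        rw [not_lt] at hnot
        have htpos : 0 < t := lt_of_lt_of_le (by positivity) hnot
        rw [hi']
        calc B / (1 + B * t) ≤ 1 / t := hwt htpos
          _ ≤ 1 / (2 ^ i' / B) := one_div_le_one_div_of_le (by positivity) hnot
          _ = 2 * B / 2 ^ (i' + 1) := by rw [pow_succ]; field_simp
    have hsingle : (2 * B / 2 ^ i : ℝ) ≤ ∑ j ∈ Finset.range (J + 1), (if t < 2 ^ j / B then 2 * B / 2 ^ j else 0) := by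
      have := Finset.single_le_sum (f := fun j => (if t < 2 ^ j / B then 2 * B / 2 ^ j else (0 : ℝ)))
        (fun j _ => by split_ifs <;> positivity) (Finset.mem_range.2 (Nat.lt_succ_of_le hi_le))
      simpa [hi_spec] using this
    have : 0 ≤ 1 / η₀ := by positivity
    linarith

/-- **The Fermi-surface weight sum.** For `μ` with `μ + 4 ≥ d₀`, `-μ ≥ d₀` there is `C = C(d₀)`
such that for all `β ≥ 1` and all `L ≥ 1`,
`Σ_{k ∈ (ℤ/Lℤ)²} β/(2 + β|ε_L(k) - μ|) ≤ C (1 + log β) L² + 8βL` — the torus Cooper-type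
logarithm `L⁻² Σ_k min(β, 1/|ξ_k|) ≲ log β` once `L ≳ β`. [folklore] -/
theorem exists_sum_fermiWeight_le {d₀ : ℝ} (hd₀ : 0 < d₀) :
    ∃ C : ℝ, 0 < C ∧ ∀ μ : ℝ, d₀ ≤ μ + 4 → d₀ ≤ -μ → ∀ β : ℝ, 1 ≤ β → ∀ (L : ℕ) [NeZero L],
      ∑ k : TorusSite 2 L, β / (2 + β * |torusBand L k - μ|) ≤
        C * (1 + Real.log β) * (L : ℝ) ^ 2 + 8 * β * L := by
  set s₀ := Real.sqrt (d₀ / 8) with hs₀def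
  have hs₀ : 0 < s₀ := Real.sqrt_pos.2 (by positivity)
  set κ : ℝ := 2 / Real.log 2 + 2 with hκ
  have hlog2 : 0 < Real.log 2 := Real.log_pos one_lt_two
  have hκpos : 0 < κ := by positivity
  refine ⟨4 / d₀ + κ * (4 / (π * s₀)), by positivity, ?_⟩
  intro μ hμ4 hμ0 β hβ L _
  have hL : (0 : ℝ) < L := by exact_mod_cast Nat.pos_of_ne_zero (NeZero.ne L)
  have hlogβ : 0 ≤ Real.log β := Real.log_nonneg hβ
  set B := β / 2 with hBdef
  have hB : 0 < B := by positivity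
  set η₀ := d₀ / 4 with hη₀def
  have hη₀ : 0 < η₀ := by positivity
  have hd₀2 : d₀ ≤ 2 := by linarith
  have hw : ∀ k : TorusSite 2 L, β / (2 + β * |torusBand L k - μ|) = B / (1 + B * |torusBand L k - μ|) := by
    intro k
    rw [hBdef]
    have : 0 < 2 + β * |torusBand L k - μ| := by positivity
    field_simp
  simp only [hw]
  have hcardL : (Finset.univ : Finset (TorusSite 2 L)).card = L ^ 2 := by
    rw [Finset.card_univ, Fintype.card_pi, Fin.prod_univ_two, ZMod.card, sq]
  by_cases hsmall : B * η₀ ≤ 1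
  · -- small `β`: every weight is `≤ B ≤ 1/η₀ = 4/d₀`
    have hsm : B * (d₀ / 4) ≤ 1 := by rw [hη₀def] at hsmall; exact hsmall
    have hbound : ∀ k : TorusSite 2 L, B / (1 + B * |torusBand L k - μ|) ≤ 4 / d₀ := fun k => by
      refine (div_le_self hB.le (by nlinarith [abs_nonneg (torusBand L k - μ)])).trans ?_
      rw [le_div_iff₀ hd₀]; linarith
    calc ∑ k : TorusSite 2 L, B / (1 + B * |torusBand L k - μ|) ≤ ∑ _k : TorusSite 2 L, 4 / d₀ :=
          Finset.sum_le_sum fun k _ => hbound k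
      _ = 4 / d₀ * (L : ℝ) ^ 2 := by rw [Finset.sum_const, hcardL, nsmul_eq_mul]; push_cast; ring
      _ ≤ (4 / d₀ + κ * (4 / (π * s₀))) * (1 + Real.log β) * (L : ℝ) ^ 2 + 8 * β * L := by
          have h1 : (0 : ℝ) ≤ κ * (4 / (π * s₀)) := by positivity
          have h2 : (0 : ℝ) ≤ (L : ℝ) ^ 2 := by positivity
          nlinarith [mul_nonneg h1 h2, mul_nonneg (mul_nonneg (show (0:ℝ) ≤ 4 / d₀ + κ * (4 / (π * s₀)) by positivity) hlogβ) h2]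
  · -- dyadic decomposition
    rw [not_le] at hsmall
    obtain ⟨n, hn1, hn2⟩ := exists_nat_pow_near hsmall.le one_lt_two
    set J := n + 1 with hJdef
    have hJ1 : η₀ ≤ 2 ^ J / B := by
      rw [le_div_iff₀ hB, hJdef]; linarith
    have hJ2 : (2 : ℝ) ^ J / B ≤ d₀ / 2 := by
      rw [div_le_iff₀ hB, hJdef, pow_succ]; nlinarith
    have hJ3 : ((J : ℕ) : ℝ) + 1 ≤ κ * (1 + Real.log β) := by
      -- `2^n ≤ Bη₀ ≤ β` gives `n log 2 ≤ log β`
      have hBη : B * η₀ ≤ β := by rw [hBdef, hη₀def]; nlinarith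
      have hn : (n : ℝ) * Real.log 2 ≤ Real.log β := by
        rw [← Real.log_pow]
        exact Real.log_le_log (by positivity) (hn1.trans hBη)
      have hc : 0 < (Real.log 2)⁻¹ := inv_pos.2 hlog2
      have hn' : (n : ℝ) ≤ Real.log β * (Real.log 2)⁻¹ := by
        rw [← div_eq_mul_inv, le_div_iff₀ hlog2]; exact hn
      rw [hJdef, hκ, div_eq_mul_inv]
      push_cast
      nlinarith [mul_nonneg hc.le hlogβ]
    -- pointwise domination and summation
    have hpt : ∀ k : TorusSite 2 L, B / (1 + B * |torusBand L k - μ|) ≤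
        1 / η₀ + ∑ j ∈ Finset.range (J + 1), (if |torusBand L k - μ| < 2 ^ j / B then 2 * B / 2 ^ j else 0) :=
      fun k => fermiWeight_le_dyadic hB (abs_nonneg _) hη₀ hJ1
    have hcount : ∀ j ∈ Finset.range (J + 1),
        ∑ k : TorusSite 2 L, (if |torusBand L k - μ| < 2 ^ j / B then 2 * B / 2 ^ j else (0 : ℝ)) ≤
          4 * (L : ℝ) ^ 2 / (π * s₀) + 8 * B * L / 2 ^ j := by
      intro j hj
      have hjJ : j ≤ J := Nat.lt_succ_iff.1 (Finset.mem_range.1 hj)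
      have hηj : 0 < (2 : ℝ) ^ j / B := by positivity
      have hηj' : (2 : ℝ) ^ j / B ≤ d₀ / 2 :=
        le_trans (div_le_div_of_nonneg_right (pow_le_pow_right₀ one_le_two hjJ) hB.le) hJ2
      have hN := card_torusShell_le (L := L) hμ4 hμ0 hηj hηj'
      rw [← hs₀def] at hN
      rw [← Finset.sum_filter, Finset.sum_const, nsmul_eq_mul]
      calc (((Finset.univ.filter fun k : TorusSite 2 L => |torusBand L k - μ| < 2 ^ j / B).card : ℕ) : ℝ) * (2 * B / 2 ^ j)
          ≤ 4 * (L * (2 ^ j / B * L / (2 * π * s₀) + 1)) * (2 * B / 2 ^ j) :=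
            mul_le_mul_of_nonneg_right hN (by positivity)
        _ = 4 * (L : ℝ) ^ 2 / (π * s₀) + 8 * B * L / 2 ^ j := by
            field_simp
            ring
    have hgeom : ∑ j ∈ Finset.range (J + 1), (8 * B * (L : ℝ) / 2 ^ j) ≤ 16 * B * L := by
      have hg := geom_sum_Ico_le_of_lt_one (show (0 : ℝ) ≤ 1 / 2 by norm_num) (show (1 : ℝ) / 2 < 1 by norm_num)
        (m := 0) (n := J + 1)
      simp only [pow_zero, Finset.range_eq_Ico] at hg ⊢
      calc ∑ j ∈ Finset.Ico 0 (J + 1), 8 * B * (L : ℝ) / 2 ^ j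
          = 8 * B * L * ∑ j ∈ Finset.Ico 0 (J + 1), ((1 : ℝ) / 2) ^ j := by
            rw [Finset.mul_sum]
            refine Finset.sum_congr rfl fun j _ => ?_
            rw [one_div, inv_pow]; ring
        _ ≤ 8 * B * L * (1 / (1 - 1 / 2)) := by gcongr
        _ = 16 * B * L := by norm_num; ring
    calc ∑ k : TorusSite 2 L, B / (1 + B * |torusBand L k - μ|)
        ≤ ∑ k : TorusSite 2 L, (1 / η₀ + ∑ j ∈ Finset.range (J + 1),
            (if |torusBand L k - μ| < 2 ^ j / B then 2 * B / 2 ^ j else 0)) := Finset.sum_le_sum fun k _ => hpt k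
      _ = (L : ℝ) ^ 2 / η₀ + ∑ j ∈ Finset.range (J + 1), ∑ k : TorusSite 2 L,
            (if |torusBand L k - μ| < 2 ^ j / B then 2 * B / 2 ^ j else (0 : ℝ)) := by
          rw [Finset.sum_add_distrib, Finset.sum_const, hcardL, nsmul_eq_mul, Finset.sum_comm]
          push_cast; ring
      _ ≤ (L : ℝ) ^ 2 / η₀ + ∑ j ∈ Finset.range (J + 1), (4 * (L : ℝ) ^ 2 / (π * s₀) + 8 * B * L / 2 ^ j) := by
          gcongr with j hj
          exact hcount j hj
      _ = (L : ℝ) ^ 2 / η₀ + ((J : ℕ) + 1 : ℝ) * (4 * (L : ℝ) ^ 2 / (π * s₀)) +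
            ∑ j ∈ Finset.range (J + 1), (8 * B * (L : ℝ) / 2 ^ j) := by
          rw [Finset.sum_add_distrib, Finset.sum_const, Finset.card_range, nsmul_eq_mul]
          push_cast; ring
      _ ≤ (L : ℝ) ^ 2 / η₀ + κ * (1 + Real.log β) * (4 * (L : ℝ) ^ 2 / (π * s₀)) + 16 * B * L := by
          gcongr
      _ ≤ (4 / d₀ + κ * (4 / (π * s₀))) * (1 + Real.log β) * (L : ℝ) ^ 2 + 8 * β * L := by
          rw [hη₀def, hBdef]
          have h2 : (0 : ℝ) ≤ (L : ℝ) ^ 2 := by positivity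
          have h3 : (L : ℝ) ^ 2 / (d₀ / 4) = 4 / d₀ * (L : ℝ) ^ 2 := by field_simp
          have h4 : κ * (1 + Real.log β) * (4 * (L : ℝ) ^ 2 / (π * s₀)) =
              κ * (4 / (π * s₀)) * (1 + Real.log β) * (L : ℝ) ^ 2 := by ring
          have h5 : (0 : ℝ) ≤ 4 / d₀ * Real.log β * (L : ℝ) ^ 2 :=
            mul_nonneg (mul_nonneg (by positivity) hlogβ) h2
          rw [h3, h4]
          nlinarith [h5]

end Literature.MathematicalPhysics.QuantumLattice
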